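import Mathlib
import HarnessLib
import Summits.HubbardSuperconductivity.HubbardSuperconductivity.Theorems.ChiralWindowDefsResidual
import Summits.HubbardSuperconductivity.HubbardSuperconductivity.Theorems.ChiralWindowCwKLChiralWindowBlockBoundsR

/-!
# `TwTipContinuation` (stmt-HubbardSuperconductivity-1700) — line `kl-mechanism-datum`,
# stub `stub_b1gPointSound` (soundness of a one-box `B₁g`-leads certificate read at its left end)

Write `ε₀ = squareDispersion 1 0` and `Λ₁(μ, χ) = channelInf ε₀ μ 1 χ` (bottom of the `U = 1` Kohn–Luttinger
pairing form in the `D₄` channel `χ`).  The certificate vocabulary is the landed one of crux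
`CwKLChiralWindow` (stmt-HubbardSuperconductivity-1741): a box `bx : KLBox` with its five channel blocks
`bx.blk χ : KLBlock`, read in RESIDUAL FORM (`Theorems/ChiralWindowDefsResidual.lean`: `KLBlock.EnclosureR`,
`templeOKR`, `lowerOKR`, `lowerR`, `KLBox.b1gLeadsOKR`).

**Statement.** At the left end `μ = bx.mulo ∈ (-4, 0)` of the box: if the `B₁g` block passes the residual-form
Temple test `templeOKR` (it contains the Ritz data) without the bare-`U` term, the four competitors `A₁g, A₂g, B₂g, E`
have certified lower bounds (`lowerOKR`), the rational comparisons `bB1g.upper + γ ≤ bχ.lowerR tab χ` hold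
(`b1gLeadsOKR`), and the residual-form enclosures of the five blocks hold at `μ`, then
`Λ₁(μ, B1g) + γ ≤ Λ₁(μ, χ)` for every `χ ≠ B1g`.

**Proof.** Pure assembly of the landed block-level soundness theorem `stub_klBlockBoundsR`
(`Theorems/ChiralWindowCwKLChiralWindowBlockBoundsR.lean`): its second clause on the `B₁g` block gives the Ritz bound
`Λ₁(μ, B1g) ≤ bB1g.upper` (equality case `χ ≠ A1g`), its first clause on the block of `χ` gives
`bχ.lowerR tab χ ≤ Λ₁(μ, χ)`, and the Boolean `b1gLeadsOKR` unpacks into the four rational inequalities in between.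
This is clause N1 of `stub_klCertNumericalRS` (`Theorems/ChiralWindowCwKLChiralWindowCertNumericalRS.lean`) on a
single box at a single level; no definitions, no numerics.

Reference: M. Reed, B. Simon, *Methods of Modern Mathematical Physics IV*, Thm. XIII.5 (Temple's inequality).
-/

noncomputable section

namespace Summit.HubbardSuperconductivity.TwTipContinuation.KlMechanismDatum

open MeasureTheory Literature.MathematicalPhysics.QuantumLattice
open Summit.HubbardSuperconductivity.HubbardSuperconductivity.Theorems
open Summit.HubbardSuperconductivity.HubbardSuperconductivity.Theorems.CwKLChiralWindow

/-- **(S) Soundness of the one-box `B₁g`-leads certificate.**  For a box `bx` of the landed record vocabulary read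
AT ITS LEFT END `μ = bx.mulo ∈ (-4,0)`: if the `B₁g` block passes the residual-form Temple test (`templeOKR`, which
contains the Ritz data) without the bare-`U` term, the four other blocks have certified lower bounds (`lowerOKR`),
the rational comparison `bB1g.upper + γ ≤ bχ.lowerR` holds for the four competitors (`b1gLeadsOKR`), and the
residual-form enclosures of the five blocks hold at `μ`, then `Λ₁(μ,B1g) + γ ≤ Λ₁(μ,χ)` for every `χ ≠ B1g` — by
`stub_klBlockBoundsR` (`lowerR ≤ channelInf`, `channelInf B1g ≤ upper`), exactly clause N1 of
`stub_klCertNumericalRS`. [cite: ReedSimonIV1978, Thm. XIII.5] -/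
theorem stub_b1gPointSound :
    ∀ (bx : KLBox) (tab : List KLTrig) (γ : ℚ),
    -4 < bx.mulo → bx.mulo < 0 →
    bx.bB1g.templeOKR tab D4Irrep.B1g = true → bx.bB1g.withU = false →
    bx.bA1g.lowerOKR tab D4Irrep.A1g = true → bx.bA2g.lowerOKR tab D4Irrep.A2g = true →
    bx.bB2g.lowerOKR tab D4Irrep.B2g = true → bx.bE.lowerOKR tab D4Irrep.E = true →
    bx.b1gLeadsOKR tab γ = true →
    (∀ χ : D4Irrep, (bx.blk χ).EnclosureR tab ((bx.mulo : ℚ) : ℝ) χ) →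
    ∀ χ : D4Irrep, χ ≠ D4Irrep.B1g →
      channelInf (squareDispersion 1 0) ((bx.mulo : ℚ) : ℝ) 1 D4Irrep.B1g + ((γ : ℚ) : ℝ) ≤
        channelInf (squareDispersion 1 0) ((bx.mulo : ℚ) : ℝ) 1 χ := by
  intro bx tab γ h4 h0 hT _hW hLA1 hLA2 hLB2 hLE hlead hE χ hχ
  -- the level `μ = bx.mulo` lies in the band `(-4, 0)`
  have hμ : ((bx.mulo : ℚ) : ℝ) ∈ Set.Ioo (-4 : ℝ) 0 := ⟨by exact_mod_cast h4, by exact_mod_cast h0⟩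
  -- the five residual-form block enclosures at `μ` (`bx.blk χ` is the named block by `rfl`)
  have hEA1 : bx.bA1g.EnclosureR tab ((bx.mulo : ℚ) : ℝ) D4Irrep.A1g := hE D4Irrep.A1g
  have hEA2 : bx.bA2g.EnclosureR tab ((bx.mulo : ℚ) : ℝ) D4Irrep.A2g := hE D4Irrep.A2g
  have hEB1 : bx.bB1g.EnclosureR tab ((bx.mulo : ℚ) : ℝ) D4Irrep.B1g := hE D4Irrep.B1g
  have hEB2 : bx.bB2g.EnclosureR tab ((bx.mulo : ℚ) : ℝ) D4Irrep.B2g := hE D4Irrep.B2g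
  have hEE : bx.bE.EnclosureR tab ((bx.mulo : ℚ) : ℝ) D4Irrep.E := hE D4Irrep.E
  -- Ritz upper bound for the `B1g` bottom (equality case `B1g ≠ A1g`)
  have hupB : channelInf (squareDispersion 1 0) ((bx.mulo : ℚ) : ℝ) 1 D4Irrep.B1g ≤ ((bx.bB1g.upper : ℚ) : ℝ) :=
    (stub_klBlockBoundsR _ hμ bx.bB1g tab D4Irrep.B1g hEB1).2 hT (Or.inr (by decide))
  -- certified lower bounds for the four competitors
  have hlowA1 : ((bx.bA1g.lowerR tab D4Irrep.A1g : ℚ) : ℝ) ≤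
      channelInf (squareDispersion 1 0) ((bx.mulo : ℚ) : ℝ) 1 D4Irrep.A1g :=
    (stub_klBlockBoundsR _ hμ bx.bA1g tab D4Irrep.A1g hEA1).1 hLA1
  have hlowA2 : ((bx.bA2g.lowerR tab D4Irrep.A2g : ℚ) : ℝ) ≤
      channelInf (squareDispersion 1 0) ((bx.mulo : ℚ) : ℝ) 1 D4Irrep.A2g :=
    (stub_klBlockBoundsR _ hμ bx.bA2g tab D4Irrep.A2g hEA2).1 hLA2
  have hlowB2 : ((bx.bB2g.lowerR tab D4Irrep.B2g : ℚ) : ℝ) ≤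
      channelInf (squareDispersion 1 0) ((bx.mulo : ℚ) : ℝ) 1 D4Irrep.B2g :=
    (stub_klBlockBoundsR _ hμ bx.bB2g tab D4Irrep.B2g hEB2).1 hLB2
  have hlowE : ((bx.bE.lowerR tab D4Irrep.E : ℚ) : ℝ) ≤
      channelInf (squareDispersion 1 0) ((bx.mulo : ℚ) : ℝ) 1 D4Irrep.E :=
    (stub_klBlockBoundsR _ hμ bx.bE tab D4Irrep.E hEE).1 hLE
  -- the Boolean `b1gLeadsOKR` unpacks into four rational inequalities
  have hl : bx.bB1g.upper + γ ≤ bx.bA1g.lowerR tab .A1g ∧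
      bx.bB1g.upper + γ ≤ bx.bA2g.lowerR tab .A2g ∧
      bx.bB1g.upper + γ ≤ bx.bB2g.lowerR tab .B2g ∧
      bx.bB1g.upper + γ ≤ bx.bE.lowerR tab .E := by
    simpa only [KLBox.b1gLeadsOKR, Bool.and_eq_true, decide_eq_true_eq, and_assoc] using hlead
  obtain ⟨hA1, hA2, hB2, hEl⟩ := hl
  cases χ with
  | A1g =>
    calc channelInf (squareDispersion 1 0) ((bx.mulo : ℚ) : ℝ) 1 D4Irrep.B1g + ((γ : ℚ) : ℝ)
        ≤ ((bx.bB1g.upper : ℚ) : ℝ) + ((γ : ℚ) : ℝ) := add_le_add hupB le_rfl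
      _ ≤ ((bx.bA1g.lowerR tab .A1g : ℚ) : ℝ) := by exact_mod_cast hA1
      _ ≤ _ := hlowA1
  | A2g =>
    calc channelInf (squareDispersion 1 0) ((bx.mulo : ℚ) : ℝ) 1 D4Irrep.B1g + ((γ : ℚ) : ℝ)
        ≤ ((bx.bB1g.upper : ℚ) : ℝ) + ((γ : ℚ) : ℝ) := add_le_add hupB le_rfl
      _ ≤ ((bx.bA2g.lowerR tab .A2g : ℚ) : ℝ) := by exact_mod_cast hA2
      _ ≤ _ := hlowA2
  | B1g => exact absurd rfl hχ
  | B2g =>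
    calc channelInf (squareDispersion 1 0) ((bx.mulo : ℚ) : ℝ) 1 D4Irrep.B1g + ((γ : ℚ) : ℝ)
        ≤ ((bx.bB1g.upper : ℚ) : ℝ) + ((γ : ℚ) : ℝ) := add_le_add hupB le_rfl
      _ ≤ ((bx.bB2g.lowerR tab .B2g : ℚ) : ℝ) := by exact_mod_cast hB2
      _ ≤ _ := hlowB2
  | E =>
    calc channelInf (squareDispersion 1 0) ((bx.mulo : ℚ) : ℝ) 1 D4Irrep.B1g + ((γ : ℚ) : ℝ)
        ≤ ((bx.bB1g.upper : ℚ) : ℝ) + ((γ : ℚ) : ℝ) := add_le_add hupB le_rfl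
      _ ≤ ((bx.bE.lowerR tab .E : ℚ) : ℝ) := by exact_mod_cast hEl
      _ ≤ _ := hlowE

end Summit.HubbardSuperconductivity.TwTipContinuation.KlMechanismDatum

end
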